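import Literature.NumberTheory.Automorphic.GodementJacquetLemma610Bounded
import Literature.NumberTheory.Automorphic.SphericalCoefficientGrowth
import Literature.NumberTheory.Automorphic.SmoothRepresentationIrreducibleContragredientProofs
import Literature.NumberTheory.Automorphic.GodementJacquetSphericalZeta
import Literature.NumberTheory.Automorphic.RankinSelbergLocalLFactor
import HarnessLib

/-!
# Godement–Jacquet's Lemma 6.10 for admissible spherical representations (discharge of
`GodementJacquet1972_lemma610`)

Topic `NumberTheory/Automorphic`; theorems only. Sibling proof file of `GodementJacquetLocal`
(the named facts of Godement–Jacquet, LNM 260 (1972), §3 and §6) on top of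
`GodementJacquetLemma610Bounded` (the unramified computation
`Z(1_{M_n(𝒪)}, s + (n-1)/2, ω°) = ∏_{a ∈ α} (1 - a q^{-s})⁻¹` for **bounded** spherical
coefficients: unfolding over the cosets of `Δ_m`, sphericality, Tamagawa's identity in Satake
form, geometric convergence of the Hecke series) and `SphericalCoefficientGrowth` (the
exponential bound `‖φ(ρ(y) v)‖ ≤ C M^m` on `Δ_m` for spherical coefficients of **admissible**
representations, from the Hecke operators of the first congruence subgroup).

* `gjLocalZeta_indicator_intMatrices_eq_of_norm_le_mul_pow`: Lemma 6.10 under the growth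
  hypothesis `‖f(y)‖ ≤ C M^m` on `Δ_m` in place of boundedness — the proof of the bounded case
  verbatim with `B D^m` replaced by `C (M D)^m` (`|r_m| ≤ C (MD)^m`, absolute convergence for
  `q^{re s'} > ⌈M⌉ D`).
* `GodementJacquet1972_lemma610_holds`: the named fact `GodementJacquet1972_lemma610` of
  `GodementJacquetLocal` (Godement–Jacquet (1972), Lemma 6.10; Jacquet (1979), (1.4)) for every
  irreducible admissible spherical representation — irreducibility is not used, admissibility
  gives the growth bound (`exists_norm_matrixCoeff_le_of_mem_glIntDet_of_mem_fixedPoints_dual`).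
* Towards `GodementJacquet1972_hasGJLFactor_of_isSatakeParameter` (the unramified `L`-factor,
  `HasGJLFactor ρ μG (eulerPolynomial α)`): `indicator_intMatrices_mem_schwartzBruhat`
  (`1_{M_n(𝒪)} ∈ 𝒮(M_n(F))`), `eval_rsLRat` (`(1/P)(t) = P(t)⁻¹`),
  `inZetaSpan_eulerPolynomial_of_isSatakeParameter` — **conjunct (b) of the predicate**:
  `∏ (1 - α_i q^{-s})⁻¹` is a Laurent combination (indeed a constant multiple) of one zeta
  integral of `π`, namely `Z(1_{M_n(𝒪)}, s + (n-1)/2, ω°)` (Lemma 6.10 with the Haar measure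
  renormalised and a `K`-invariant smooth `φ` with `φ(v°) = 1` from
  `IsSmooth.exists_mem_contragredient_apply_ne_zero_of_mem_fixedPoints`) — and
  `hasGJLFactor_eulerPolynomial_iff_of_isSatakeParameter`: for spherical `π` with Satake
  parameter `α`, `HasGJLFactor ρ μG (eulerPolynomial α)` holds **iff** every zeta integral of `π`
  is `(Laurent)/∏(1 - α_i T)` at `T = q^{-s}` (conjunct (a), Godement–Jacquet's divisibility
  `L(s, π)⁻¹ ∣ ∏ (1 - α_i q^{-s})` for constituents of unramified principal series, LNM 260 §3).
* `GodementJacquet1972_hasGJLFactor_of_isSatakeParameter_holds` — **discharge of the named fact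
  `GodementJacquet1972_hasGJLFactor_of_isSatakeParameter`** (the unramified `L`-factor:
  `HasGJLFactor ρ μG (∏ (1 - α_i T))` for every irreducible admissible spherical `π` with Satake
  parameter `α` and every Haar measure). Conjunct (a) is proved here by an elementary route
  avoiding the principal series: by cyclicity of `v°` in `V` and of `φ°` in `Ṽ`
  (`exists_finsupp_sum_smul_apply_eq`, `isIrreducible_contragredient_holds`) every coefficient
  is a finite combination of two-sided translates `x ↦ ω°(h⁻¹ x g)` of the zonal spherical
  function, and translations move onto the test function (`gjLocalZeta_matrixCoeff_apply`,
  `gjLocalZeta_matrixCoeff_dual`; unimodularity `isMulRightInvariant_of_isHaarMeasure_gl`);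
  the test function is reduced to the lattice indicators `1_{M_n(𝒪)}(z⁻¹ ·)`
  (`exists_gjLocalZeta_eq_sum_indicator` of `GodementJacquetSphericalZeta`, resting on the Möbius
  expansion `exists_eq_sum_indicator_intMatrices_of_mem_schwartzBruhat` of
  `SchwartzBruhatLatticeSpan`); `Z(1_M(z⁻¹ ·), s, ω°) = |det z|^s ω°(z) Z(1_M, s, ω°)`
  (`gjLocalZeta_indicator_mul_left_eq_spherical`, the functional equation of the spherical
  function); and `Z(1_M, s + (n-1)/2, ω°) = μG(K) ∏ (1 - α_i q^{-s})⁻¹` is Lemma 6.10. Every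
  `|det w|^{s + (n-1)/2}` is a constant times an integral power of `q^{-s}`
  (`exists_int_cpow_normAbs_det_eq`), whence the Laurent numerator
  (`exists_isLaurent_eventually_evalAtQ_eq_sum`). Absolute convergence throughout is
  `GodementJacquet1972_local_convergence_holds`.

## References

* R. Godement, H. Jacquet, *Zeta functions of simple algebras*, LNM 260 (1972), Lemma 6.10
  [GodementJacquet1972] (not held; statement as recorded in `GodementJacquetLocal`).
* H. Jacquet, *Principal L-functions of the linear group*, Proc. Sympos. Pure Math. 33 (1979),
  Part 2, (1.4) [JacquetCorvallis1979].
* T. Tamagawa, *On the ζ-functions of a division algebra*, Ann. of Math. 77 (1963)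
  [TamagawaAnnals1963].
-/

noncomputable section

open scoped Pointwise NNReal
open MulAction ValuativeRel Matrix Finset MeasureTheory Function Polynomial
  Literature.LinearAlgebra.Matrix.Echelon Literature.NumberTheory.Automorphic.Echelon
  Literature.NumberTheory.GaloisRepresentations.IsNonarchimedeanLocalField

namespace Literature.NumberTheory.Automorphic

/-! ### Lemma 6.10 under an exponential growth hypothesis -/

section Growth

variable {F : Type*} [Field F] [ValuativeRel F] {n : ℕ} [TopologicalSpace F]
  [IsNonarchimedeanLocalField F] [MeasurableSpace (GL (Fin n) F)] [BorelSpace (GL (Fin n) F)]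

/-- **Godement–Jacquet's Lemma 6.10 (the unramified computation) under an exponential growth
hypothesis.** Let `F` be a non-archimedean local field with `q` elements in the residue field,
`μG` a left-invariant measure on `GL_n(F)` giving `K = GL_n(𝒪)` volume `1`, `ρ` a representation
on a complex vector space which is **spherical** (`dim V^K = 1`) with Satake parameter `α`
(`IsSatakeParameter ρ ϖ α`, unitary normalisation, `|ϖ| = q⁻¹`), `v ∈ V^K` and `φ` a linear form
with `φ(v) = 1`, and suppose the coefficient `f(g) = φ(ρ(g) v)` satisfies `‖f(y)‖ ≤ C M^m` for
`y ∈ Δ_m` (`C ≥ 0`, `M ≥ 1`; automatic for admissible `ρ`, `SphericalCoefficientGrowth`). Then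
for `re s > ⌈M⌉ #(K t_1 K / K) + 1` the local zeta integral of `f` against `Φ° = 1_{M_n(𝒪)}` at
`s + (n-1)/2` converges absolutely and equals `∏_{a ∈ α} (1 - a q^{-s})⁻¹`, the value of
`(eulerPolynomial α)(q^{-s})⁻¹`. The proof is that of the bounded case
(`gjLocalZeta_indicator_intMatrices_eq_of_norm_le`): unfold over the cosets `yK ⊆ Δ_m`,
`∑_{yK ⊆ Δ_m} f(y) = r_m` (sphericality), Tamagawa's identity in Satake form and the analytic
summation with `|r_m| ≤ C · #(Δ_m K/K) M^m ≤ C (M D)^m`. (Godement–Jacquet (1972), Lemma 6.10;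
Jacquet (1979), (1.4); Tamagawa (1963).) [cite: GodementJacquet1972, Lemma 6.10] -/
theorem gjLocalZeta_indicator_intMatrices_eq_of_norm_le_mul_pow (μG : Measure (GL (Fin n) F))
    [μG.IsMulLeftInvariant] (hμ : μG (glInt n F : Set (GL (Fin n) F)) = 1)
    {V : Type*} [AddCommGroup V] [Module ℂ V] (ρ : Representation ℂ (GL (Fin n) F) V)
    (hsph : ρ.IsSpherical (glInt n F)) {ϖ : Fˣ}
    (hϖ : normAbs F (ϖ : F) = ((residueFieldCard F : ℝ≥0))⁻¹) {α : Multiset ℂ}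
    (hα : IsSatakeParameter ρ ϖ α) {v : V} (hv : v ∈ ρ.fixedPoints (glInt n F))
    {φ : Module.Dual ℂ V} (h1 : φ v = 1) {C M : ℝ} (hC : 0 ≤ C) (hM : 1 ≤ M)
    (hB : ∀ m : ℕ, ∀ g ∈ glIntDet n (ϖ : F) m, ‖ρ.matrixCoeff φ v g‖ ≤ C * M ^ m) :
    ∃ c : ℝ, ∀ s : ℂ, c < s.re →
      Integrable (gjLocalIntegrand ((intMatrices n F).indicator 1) (ρ.matrixCoeff φ v)
        (s + ((n : ℂ) - 1) / 2)) μG ∧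
      gjLocalZeta μG ((intMatrices n F).indicator 1) (ρ.matrixCoeff φ v)
          (s + ((n : ℂ) - 1) / 2) =
        ((eulerPolynomial α).eval ((residueFieldCard F : ℂ) ^ (-s)))⁻¹ := by
  classical
  have hϖu : IsUniformizingElement (ϖ : F) := isUniformizingElement_of_normAbs_eq hϖ
  -- notation and basic facts
  set q : ℕ := residueFieldCard F with hqdef
  have hq1 : 1 < q := one_lt_residueFieldCard F
  have hq0 : 0 < q := lt_trans zero_lt_one hq1
  have hqC : (q : ℂ) ≠ 0 := Nat.cast_ne_zero.mpr hq0.ne'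
  set f : GL (Fin n) F → ℂ := ρ.matrixCoeff φ v with hfdef
  have e0 : Units.mk0 (ϖ : F) hϖu.ne_zero = ϖ := Units.mk0_val _ _
  have hv0 : v ≠ 0 := fun h => by rw [h, map_zero] at h1; exact zero_ne_one h1
  have hM0 : 0 ≤ M := zero_le_one.trans hM
  set D : ℕ := (MulAction.orbit (glInt n F) ((heckeDiag n (Units.mk0 (ϖ : F) hϖu.ne_zero) 1 :
    GL (Fin n) F) : GL (Fin n) F ⧸ glInt n F)).ncard with hDdef
  have hD1 : 1 ≤ D := (one_le_ncard_orbit_heckeDiag_one hϖu).2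
  -- a natural number dominating `M D`, for the abscissa
  set D' : ℕ := ⌈M⌉₊ * D with hD'def
  have hMD : M * (D : ℝ) ≤ (D' : ℝ) := by
    rw [hD'def]
    push_cast
    exact mul_le_mul_of_nonneg_right (Nat.le_ceil M) (Nat.cast_nonneg D)
  -- representatives of the cosets of `Δ_m` lie in `Δ_m`
  have memΔ : ∀ {m : ℕ} {γ : GL (Fin n) F ⧸ glInt n F},
      γ ∈ (finite_cosets_glIntDet (n := n) hϖu m).toFinset → γ.out ∈ glIntDet n (ϖ : F) m := by
    intro m γ hγ
    rwa [Set.Finite.mem_toFinset] at hγ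
  -- the eigenvalues `r_m` of `T(ϖ^m)` on `v`
  set r : ℕ → ℂ := fun m => ∑ γ ∈ (finite_cosets_glIntDet (n := n) hϖu m).toFinset, f γ.out
    with hrdef
  have hr : ∀ m, heckeDetOperator ρ (ϖ : F) m v = r m • v := fun m =>
    heckeDetOperator_apply_eq_smul_of_isSpherical ρ hsph hv h1 m (finite_cosets_glIntDet hϖu m)
  -- the eigenvalues of `T_i` on `v` from the Satake parameter
  obtain ⟨hcard, v', hv', hv'0, hT⟩ := hα
  have hτ : ∀ i ≤ n, heckeOperator ρ (glInt n F) (heckeDiag n (Units.mk0 (ϖ : F) hϖu.ne_zero) i) v =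
      ((((Real.sqrt (Nat.card 𝓀[F]) : ℝ) : ℂ) ^ (i * (n - i))) * α.esymm i) • v := by
    intro i hi
    refine heckeOperator_apply_eq_smul_of_isSpherical ρ hsph hv h1 hv' hv'0 ?_
    rw [e0, ← heckeT_def, hT i hi]
    congr 1
    push_cast
    rfl
  -- the bound `‖r_m‖ ≤ C (M D)^m`
  have hrB : ∀ m, ‖r m‖ ≤ C * (M * (D : ℝ)) ^ m := by
    intro m
    calc ‖r m‖ ≤ ∑ γ ∈ (finite_cosets_glIntDet (n := n) hϖu m).toFinset, ‖f γ.out‖ :=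
          norm_sum_le _ _
      _ ≤ ∑ _γ ∈ (finite_cosets_glIntDet (n := n) hϖu m).toFinset, C * M ^ m :=
          Finset.sum_le_sum fun γ hγ => hB m _ (memΔ hγ)
      _ = (finite_cosets_glIntDet (n := n) hϖu m).toFinset.card * (C * M ^ m) := by
          rw [Finset.sum_const, nsmul_eq_mul]
      _ ≤ (D : ℝ) ^ m * (C * M ^ m) :=
          mul_le_mul_of_nonneg_right (by exact_mod_cast card_cosets_glIntDet_le_pow hϖu m)
            (mul_nonneg hC (pow_nonneg hM0 m))
      _ = C * (M * (D : ℝ)) ^ m := by ring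
  -- Tamagawa's identity in Satake form
  have hps := mk_heckeDetEigenvalue_mul_eulerFactor_eq_one ρ hϖu hv hv0 hcard hτ hr
  -- the abscissa
  refine ⟨(D' : ℝ) + 1, fun s hs => ?_⟩
  set s' : ℂ := s + ((n : ℂ) - 1) / 2 with hs'def
  set x : ℂ := (q : ℂ) ^ (-s') with hxdef
  have hres' : (D' : ℝ) < s'.re := by
    have e1 : s'.re = s.re + ((n : ℝ) - 1) / 2 := by
      simp [hs'def, Complex.add_re, Complex.div_ofNat_re]
    rw [e1]
    have : (0 : ℝ) ≤ n := Nat.cast_nonneg n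
    linarith
  have hxnorm : ‖x‖ = (q : ℝ) ^ (-s'.re) := by
    rw [hxdef, Complex.norm_natCast_cpow_of_pos hq0, Complex.neg_re]
  have hxD' : ‖x‖ * D' < 1 := by
    rw [hxnorm, Real.rpow_neg (Nat.cast_nonneg q), inv_mul_lt_iff₀ (Real.rpow_pos_of_pos
      (Nat.cast_pos.mpr hq0) _), mul_one]
    calc (D' : ℝ) < (2 : ℝ) ^ (D' : ℝ) := by
          rw [Real.rpow_natCast]; exact_mod_cast Nat.lt_two_pow_self
      _ < (2 : ℝ) ^ s'.re := (Real.rpow_lt_rpow_left_iff one_lt_two).mpr hres'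
      _ ≤ (q : ℝ) ^ s'.re := Real.rpow_le_rpow zero_le_two (by exact_mod_cast hq1)
          (le_trans (Nat.cast_nonneg D') hres'.le)
  have hxD : ‖x‖ * (M * (D : ℝ)) < 1 :=
    lt_of_le_of_lt (mul_le_mul_of_nonneg_left hMD (norm_nonneg x)) hxD'
  -- the analytic form of the Hecke series
  obtain ⟨hsumr, hval⟩ := tsum_mul_prod_one_sub_eq_one hps (mul_nonneg hM0 (Nat.cast_nonneg D))
    hrB hxD
  -- the integrand, unfolded over the cosets in `M_n(𝒪)`
  set Fn : GL (Fin n) F → ℂ := fun y => f y *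
    ((((normAbs F ((Matrix.GeneralLinearGroup.det y : Fˣ) : F)) : ℝ≥0) : ℝ) : ℂ) ^ s' with hFndef
  have hFK : ∀ y : GL (Fin n) F, ∀ k ∈ glInt n F, Fn (y * k) = Fn y := by
    intro y k hk
    simp only [hFndef, hfdef, Representation.matrixCoeff, map_mul, Module.End.mul_apply,
      (ρ.mem_fixedPoints _ v).1 hv k hk, Units.val_mul, map_mul,
      normAbs_det_eq_one_of_mem_glInt hk, mul_one]
  have hFval : ∀ m, ∀ γ ∈ (finite_cosets_glIntDet (n := n) hϖu m).toFinset,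
      Fn γ.out = f γ.out * x ^ m := by
    intro m γ hγ
    rw [Set.Finite.mem_toFinset, Set.mem_setOf_eq] at hγ
    simp only [hFndef]
    congr 1
    rw [normAbs_det_of_mem_glIntDet hγ, hϖ, hxdef, ← inv_natCast_pow_cpow]
    congr 1
    push_cast
    rw [inv_pow]
  have hsumFn : Summable fun m : ℕ =>
      ∑ γ ∈ (finite_cosets_glIntDet (n := n) hϖu m).toFinset, ‖Fn γ.out‖ := by
    have hgeom : Summable fun m : ℕ => C * ((M * (D : ℝ)) * ‖x‖) ^ m :=
      (summable_geometric_of_lt_one (mul_nonneg (mul_nonneg hM0 (Nat.cast_nonneg D))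
        (norm_nonneg x)) (by rwa [mul_comm])).mul_left C
    refine Summable.of_nonneg_of_le (fun m => Finset.sum_nonneg fun _ _ => norm_nonneg _)
      (fun m => ?_) hgeom
    calc ∑ γ ∈ (finite_cosets_glIntDet (n := n) hϖu m).toFinset, ‖Fn γ.out‖
        = ∑ γ ∈ (finite_cosets_glIntDet (n := n) hϖu m).toFinset, ‖f γ.out‖ * ‖x‖ ^ m := by
          refine Finset.sum_congr rfl fun γ hγ => ?_
          rw [hFval m γ hγ, norm_mul, norm_pow]
      _ ≤ ∑ _γ ∈ (finite_cosets_glIntDet (n := n) hϖu m).toFinset, C * M ^ m * ‖x‖ ^ m :=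
          Finset.sum_le_sum fun γ hγ => mul_le_mul_of_nonneg_right (hB m _ (memΔ hγ))
            (pow_nonneg (norm_nonneg x) m)
      _ = (finite_cosets_glIntDet (n := n) hϖu m).toFinset.card * (C * M ^ m * ‖x‖ ^ m) := by
          rw [Finset.sum_const, nsmul_eq_mul]
      _ ≤ (D : ℝ) ^ m * (C * M ^ m * ‖x‖ ^ m) :=
          mul_le_mul_of_nonneg_right (by exact_mod_cast card_cosets_glIntDet_le_pow hϖu m)
            (mul_nonneg (mul_nonneg hC (pow_nonneg hM0 m)) (pow_nonneg (norm_nonneg x) m))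
      _ = C * ((M * (D : ℝ)) * ‖x‖) ^ m := by ring
  have hμK : μG (glInt n F : Set (GL (Fin n) F)) < ⊤ := by rw [hμ]; exact ENNReal.one_lt_top
  obtain ⟨hint, hhas⟩ := setIntegral_isIntegralMatrix_eq (E := ℂ) hϖu hμK hFK hsumFn
  -- the unfolded integral is the Hecke series `∑ r_m x^m`
  have hhas' : HasSum (fun m : ℕ => r m * x ^ m)
      (∫ y in {y : GL (Fin n) F | IsIntegralMatrix (y : Matrix (Fin n) (Fin n) F)}, Fn y ∂μG) := by
    have e : (fun m : ℕ => (μG (glInt n F)).toReal •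
        ∑ γ ∈ (finite_cosets_glIntDet (n := n) hϖu m).toFinset, Fn γ.out) =
        fun m : ℕ => r m * x ^ m := by
      funext m
      rw [hμ, ENNReal.toReal_one, one_smul, hrdef, Finset.sum_mul]
      exact Finset.sum_congr rfl fun γ hγ => hFval m γ hγ
    rw [e] at hhas
    exact hhas
  -- measurability of the integral matrices (a union of open cosets)
  have hSm : MeasurableSet {y : GL (Fin n) F | IsIntegralMatrix (y : Matrix (Fin n) (Fin n) F)} := by
    rw [setOf_isIntegralMatrix_eq_iUnion hϖu]
    refine MeasurableSet.iUnion fun m => ?_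
    rw [setOf_mem_glIntDet_eq]
    exact (isOpen_setOf_mk_mem _).measurableSet
  have hintegrand : gjLocalIntegrand ((intMatrices n F).indicator 1) f s' =
      {y : GL (Fin n) F | IsIntegralMatrix (y : Matrix (Fin n) (Fin n) F)}.indicator Fn :=
    funext fun y => gjLocalIntegrand_indicator_intMatrices f s' y
  refine ⟨?_, ?_⟩
  · rw [hintegrand, integrable_indicator_iff hSm]
    exact hint
  · rw [gjLocalZeta, hintegrand, integral_indicator hSm, ← hhas'.tsum_eq,
      eq_inv_of_mul_eq_one_left hval]
    congr 1
    -- `∏ (1 - q^{(n-1)/2} a q^{-s'}) = eulerPolynomial α` at `q^{-s}`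
    rw [eval_eulerPolynomial]
    rcases Nat.eq_zero_or_pos n with hn | hn
    · subst hn
      rw [Multiset.card_eq_zero.mp hcard]
      simp
    · congr 1
      refine Multiset.map_congr rfl fun a _ => ?_
      have hcx : (((Real.sqrt (Nat.card 𝓀[F]) : ℝ) : ℂ) ^ (n - 1)) * x = (q : ℂ) ^ (-s) := by
        have h12 : ((Real.sqrt (Nat.card 𝓀[F]) : ℝ) : ℂ) = (q : ℂ) ^ ((1 / 2 : ℂ)) := by
          rw [show (Nat.card 𝓀[F] : ℝ) = (q : ℝ) from rfl, Real.sqrt_eq_rpow,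
            Complex.ofReal_cpow (Nat.cast_nonneg q)]
          push_cast
          rfl
        have hsq : (((Real.sqrt (Nat.card 𝓀[F]) : ℝ) : ℂ) ^ (n - 1)) =
            (q : ℂ) ^ (((n : ℂ) - 1) / 2) := by
          rw [h12, ← Complex.cpow_nat_mul,
            show ((n - 1 : ℕ) : ℂ) * (1 / 2) = ((n : ℂ) - 1) / 2 by
              push_cast [Nat.cast_sub hn]; ring]
        rw [hsq, hxdef, hs'def, ← Complex.cpow_add _ _ hqC,
          show ((n : ℂ) - 1) / 2 + -(s + ((n : ℂ) - 1) / 2) = -s by ring]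
      rw [mul_assoc, mul_comm a x, ← mul_assoc, hcx, mul_comm]

end Growth

/-! ### Discharge of the named fact -/

section Holds

variable {F : Type} [Field F] [ValuativeRel F] [TopologicalSpace F] [IsNonarchimedeanLocalField F]
  {n : ℕ}

/-- **Godement–Jacquet (1972), Lemma 6.10 holds**: discharge of the named fact
`GodementJacquet1972_lemma610` of `GodementJacquetLocal` — for an irreducible admissible spherical
representation with Satake parameter `α`, `v ∈ V^K`, `φ ∈ (V^*)^K` with `φ(v) = 1` and a Haar
measure with `vol(K) = 1`, `Z(1_{M_n(𝒪)}, s + (n-1)/2, φ(ρ(·) v))` converges absolutely for `re s`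
large and equals `∏_{a ∈ α} (1 - a q^{-s})⁻¹`. Admissibility supplies the growth bound
`‖φ(ρ(y) v)‖ ≤ C M^m` on `Δ_m`
(`exists_norm_matrixCoeff_le_of_mem_glIntDet_of_mem_fixedPoints_dual`), and
`gjLocalZeta_indicator_intMatrices_eq_of_norm_le_mul_pow` concludes; irreducibility is not used.
(Godement–Jacquet (1972), Lemma 6.10; Jacquet (1979), (1.4).)
[cite: GodementJacquet1972, Lemma 6.10] -/
theorem GodementJacquet1972_lemma610_holds : GodementJacquet1972_lemma610 (F := F) (n := n) := by
  intro _ _ μG _ hμ V _ _ ρ _ hρ hsph ϖ hϖ α hα v hv φ hφ h1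
  obtain ⟨C, M, hC, hM, hB⟩ :=
    exists_norm_matrixCoeff_le_of_mem_glIntDet_of_mem_fixedPoints_dual ρ hρ
      (isUniformizingElement_of_normAbs_eq hϖ) hv hφ
  exact gjLocalZeta_indicator_intMatrices_eq_of_norm_le_mul_pow μG hμ ρ hsph hϖ hα hv h1 hC hM hB

end Holds

/-! ### Towards the unramified `L`-factor: conjunct (b) of `HasGJLFactor ρ μG (eulerPolynomial α)` -/

section PartB

variable {F : Type} [Field F] [ValuativeRel F] [TopologicalSpace F] [IsNonarchimedeanLocalField F]
  {n : ℕ}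

/-- `1_{M_n(𝒪_F)}` is a Schwartz–Bruhat function on `M_n(F)`: `M_n(𝒪)` is open and closed
(finitely many coordinate conditions `x_{ij} ∈ 𝒪`, `𝒪` clopen) and compact (`𝒪` compact), so
its indicator is locally constant with compact support (Godement–Jacquet (1972), §6, the test
function `Φ°`; Jacquet (1979), (1.4)). [folklore] -/
theorem indicator_intMatrices_mem_schwartzBruhat :
    (intMatrices n F).indicator (1 : Matrix (Fin n) (Fin n) F → ℂ) ∈
      SchwartzBruhat (Matrix (Fin n) (Fin n) F) := by
  have hrepr : intMatrices n F =
      ⋂ i : Fin n, ⋂ j : Fin n, (fun x : Matrix (Fin n) (Fin n) F => x i j) ⁻¹' (𝒪[F] : Set F) := by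
    ext x
    simp only [mem_intMatrices_iff, Set.mem_iInter, Set.mem_preimage, SetLike.mem_coe]
  have hcont : ∀ i j : Fin n, Continuous fun x : Matrix (Fin n) (Fin n) F => x i j :=
    fun i j => (continuous_apply j).comp (continuous_apply i)
  have hO : IsOpen (intMatrices n F) := by
    rw [hrepr]
    exact isOpen_iInter_of_finite fun i => isOpen_iInter_of_finite fun j =>
      (Valuation.isOpen_integer (v := valuation F)).preimage (hcont i j)
  have hC : IsClosed (intMatrices n F) := by
    rw [hrepr]
    exact isClosed_iInter fun i => isClosed_iInter fun j =>
      (Valuation.isClosed_integer (v := valuation F)).preimage (hcont i j)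
  have hK : IsCompact (intMatrices n F) := by
    have hOc : IsCompact ((𝒪[F] : Set F)) := _root_.IsNonarchimedeanLocalField.isCompact_closedBall F 1
    have e : intMatrices n F = Set.pi Set.univ fun _ : Fin n => Set.pi Set.univ fun _ : Fin n =>
        (𝒪[F] : Set F) :=
      Set.ext fun x => ⟨fun hx i _ j _ => hx i j, fun hx i j => hx i (Set.mem_univ i) j (Set.mem_univ j)⟩
    rw [e]
    exact isCompact_univ_pi fun _ => isCompact_univ_pi fun _ => hOc
  rw [mem_schwartzBruhat_iff]
  refine ⟨?_, HasCompactSupport.intro' hK hC fun x hx => Set.indicator_of_notMem hx _⟩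
  rw [IsLocallyConstant.iff_exists_open]
  intro x
  by_cases hx : x ∈ intMatrices n F
  · exact ⟨intMatrices n F, hO, hx, fun x' hx' => by
      rw [Set.indicator_of_mem hx', Set.indicator_of_mem hx]; rfl⟩
  · exact ⟨(intMatrices n F)ᶜ, hC.isOpen_compl, hx, fun x' hx' => by
      rw [Set.indicator_of_notMem hx', Set.indicator_of_notMem hx]⟩

/-- `(1/P)(t) = P(t)⁻¹` for Mathlib's pole-sensitive evaluation of `1/P ∈ ℂ(T)` (`P ≠ 0`; at a
zero of `P` both sides are the junk value `0`): `1/P` has reduced numerator `c` and denominator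
`c P`, `c = lc(P)⁻¹`. [folklore] -/
theorem eval_rsLRat {P : ℂ[X]} (hP : P ≠ 0) (t : ℂ) :
    (rsLRat P).eval (RingHom.id ℂ) t = (P.eval t)⁻¹ := by
  classical
  have e : rsLRat P = algebraMap ℂ[X] (RatFunc ℂ) 1 / algebraMap ℂ[X] (RatFunc ℂ) P := by
    rw [rsLRat, map_one, one_div]
  have hg : gcd (1 : ℂ[X]) P = 1 := gcd_one_left P
  have hlc : (P.leadingCoeff)⁻¹ ≠ 0 := inv_ne_zero (Polynomial.leadingCoeff_ne_zero.mpr hP)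
  rw [e, RatFunc.eval, RatFunc.num_div, RatFunc.denom_div (1 : ℂ[X]) hP, hg,
    EuclideanDomain.div_one, EuclideanDomain.div_one, Polynomial.eval₂_mul, Polynomial.eval₂_mul,
    Polynomial.eval₂_C, Polynomial.eval₂_one, Polynomial.eval₂_id, RingHom.id_apply, mul_one,
    ← div_div, div_self hlc, one_div]

/-- **Conjunct (b) of `HasGJLFactor ρ μG (eulerPolynomial α)`: the unramified `L`-factor is
attained by a zeta integral.** Let `π` (`ρ` on `V`) be an admissible representation of `GL_n(F)`
which is spherical with Satake parameter `α` (`|ϖ| = q⁻¹`), and `μG` any Haar measure. Then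
`∏_{a ∈ α} (1 - a q^{-s})⁻¹ = c · Z(1_{M_n(𝒪)}, s + (n-1)/2, ω°)` for `re s` large, with
`ω°(g) = φ(ρ(g) v°)`, `v°` the spherical vector, `φ ∈ Ṽ` `K`-invariant with `φ(v°) = 1`
(`IsSmooth.exists_mem_contragredient_apply_ne_zero_of_mem_fixedPoints`) and `c = μG(K)⁻¹`: the
datum `k = 1`, `Φ = 1_{M_n(𝒪)}`, `Q = C(μG(K)⁻¹)` of the predicate. This is
`GodementJacquet1972_lemma610_holds` for the renormalised Haar measure `μG(K)⁻¹ μG`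
(Godement–Jacquet (1972), Lemma 6.10 ⇒ `L(s, π) ∈ I(π)`; Jacquet (1979), (1.4)).
[cite: GodementJacquet1972, Lemma 6.10] -/
theorem inZetaSpan_eulerPolynomial_of_isSatakeParameter [MeasurableSpace (GL (Fin n) F)]
    [BorelSpace (GL (Fin n) F)] (μG : Measure (GL (Fin n) F)) [μG.IsHaarMeasure]
    {V : Type} [AddCommGroup V] [Module ℂ V] (ρ : Representation ℂ (GL (Fin n) F) V)
    [ρ.IsIrreducible] (hρ : ρ.IsAdmissible) (hsph : ρ.IsSpherical (glInt n F)) {ϖ : Fˣ}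
    (hϖ : normAbs F (ϖ : F) = ((residueFieldCard F : ℝ≥0))⁻¹) {α : Multiset ℂ}
    (hα : IsSatakeParameter ρ ϖ α) :
    ∃ (k : ℕ) (Φ : Fin k → Matrix (Fin n) (Fin n) F → ℂ) (φ : Fin k → Module.Dual ℂ V)
      (v : Fin k → V) (Q : Fin k → RatFunc ℂ),
      (∀ i, Φ i ∈ SchwartzBruhat (Matrix (Fin n) (Fin n) F)) ∧ (∀ i, φ i ∈ ρ.contragredient) ∧
      (∀ i, IsLaurent (Q i)) ∧
      EqOnRightHalfPlane (residueFieldCard F)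
        (fun s => ∑ i, evalAtQ (residueFieldCard F) (Q i) s *
          gjLocalZeta μG (Φ i) (ρ.matrixCoeff (φ i) (v i)) (s + ((n : ℂ) - 1) / 2))
        (rsLRat (eulerPolynomial α)) := by
  -- the spherical vector `v` and a `K`-invariant smooth `φ` with `φ v = 1`
  obtain ⟨v, hv, hv0, -⟩ := hα.2
  obtain ⟨f, hf, hfK, hfv⟩ :=
    hρ.isSmooth.exists_mem_contragredient_apply_ne_zero_of_mem_fixedPoints (isOpen_glInt n F)
      (isCompact_glInt n F) hv hv0
  set φ : Module.Dual ℂ V := (f v)⁻¹ • f with hφdef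
  have hφ : φ ∈ ρ.contragredient := Submodule.smul_mem _ _ hf
  have hφK : φ ∈ ρ.dual.fixedPoints (glInt n F) := by
    rw [Representation.mem_fixedPoints]
    intro g hg
    rw [hφdef, map_smul, hfK g hg]
  have h1 : φ v = 1 := by
    rw [hφdef, LinearMap.smul_apply, smul_eq_mul, inv_mul_cancel₀ hfv]
  -- the renormalised Haar measure `μ' = μG(K)⁻¹ μG`
  have hK0 : μG (glInt n F : Set (GL (Fin n) F)) ≠ 0 :=
    (isOpen_glInt n F).measure_ne_zero μG ⟨1, (glInt n F).one_mem⟩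
  have hKtop : μG (glInt n F : Set (GL (Fin n) F)) ≠ ⊤ := (isCompact_glInt n F).measure_lt_top.ne
  set μ' : Measure (GL (Fin n) F) := (μG (glInt n F : Set (GL (Fin n) F)))⁻¹ • μG with hμ'def
  haveI : μ'.IsHaarMeasure :=
    Measure.IsHaarMeasure.smul μG (ENNReal.inv_ne_zero.mpr hKtop) (ENNReal.inv_ne_top.mpr hK0)
  have hμ'K : μ' (glInt n F : Set (GL (Fin n) F)) = 1 := by
    rw [hμ'def, Measure.smul_apply, smul_eq_mul, ENNReal.inv_mul_cancel hK0 hKtop]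
  obtain ⟨c, hc⟩ := GodementJacquet1972_lemma610_holds μ' hμ'K ρ hρ hsph hϖ hα hv hφK h1
  -- the constant `Q = C(μG(K)⁻¹)` and the comparison of the two zeta integrals
  set r : ℝ := (μG (glInt n F : Set (GL (Fin n) F))).toReal with hrdef
  have hr0 : r ≠ 0 := ENNReal.toReal_ne_zero.mpr ⟨hK0, hKtop⟩
  have hZ : ∀ s : ℂ, gjLocalZeta μG ((intMatrices n F).indicator 1) (ρ.matrixCoeff φ v) s =
      (r : ℂ) * gjLocalZeta μ' ((intMatrices n F).indicator 1) (ρ.matrixCoeff φ v) s := by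
    intro s
    rw [gjLocalZeta, gjLocalZeta, hμ'def, integral_smul_measure, ENNReal.toReal_inv, ← hrdef,
      Complex.real_smul, ← mul_assoc, Complex.ofReal_inv, mul_inv_cancel₀
      (Complex.ofReal_ne_zero.mpr hr0), one_mul]
  have hE0 : eulerPolynomial α ≠ 0 := fun h => by
    have := eval_zero_eulerPolynomial α
    rw [h, Polynomial.eval_zero] at this
    exact zero_ne_one this
  refine ⟨1, fun _ => (intMatrices n F).indicator 1, fun _ => φ, fun _ => v,
    fun _ => RatFunc.C ((r : ℂ)⁻¹), fun _ => indicator_intMatrices_mem_schwartzBruhat,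
    fun _ => hφ, fun _ => ⟨Polynomial.C ((r : ℂ)⁻¹), 0, by simp⟩, c, fun s hs => ?_⟩
  dsimp only
  rw [Fin.sum_univ_one, hZ, (hc s hs).2, evalAtQ, evalAtQ, RatFunc.eval_C, RingHom.id_apply,
    eval_rsLRat hE0, ← mul_assoc, inv_mul_cancel₀ (Complex.ofReal_ne_zero.mpr hr0), one_mul]

/-- **The unramified `L`-factor, reduced to the divisibility.** For an admissible spherical
`π` with Satake parameter `α` and any Haar measure `μG`, `HasGJLFactor ρ μG (eulerPolynomial α)`
(`L(s, π) = ∏ (1 - α_i q^{-s})⁻¹` in the tree's predicate form) holds **iff** every zeta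
integral `Z(Φ, s + (n-1)/2, f)` of `π` agrees for `re s ≫ 0` with `R(q^{-s}) / ∏ (1 - α_i q^{-s})`
for a Laurent polynomial `R` — conjunct (a) alone, since `∏ (1 - α_i T)` has constant term `1`
and conjunct (b) is `inZetaSpan_eulerPolynomial_of_isSatakeParameter` (Lemma 6.10). The
remaining conjunct is Godement–Jacquet's `L(s, π)⁻¹ ∣ ∏_i (1 - χ_i(ϖ) q^{-s})` for constituents
of the unramified principal series `Ind(χ_1, …, χ_n)` (LNM 260, §3; Jacquet (1979), §3), which
is what separates this file from the named fact
`GodementJacquet1972_hasGJLFactor_of_isSatakeParameter`. [cite: GodementJacquet1972, Lemma 6.10 with Thm. 3.3] -/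
theorem hasGJLFactor_eulerPolynomial_iff_of_isSatakeParameter [MeasurableSpace (GL (Fin n) F)]
    [BorelSpace (GL (Fin n) F)] (μG : Measure (GL (Fin n) F)) [μG.IsHaarMeasure]
    {V : Type} [AddCommGroup V] [Module ℂ V] (ρ : Representation ℂ (GL (Fin n) F) V)
    [ρ.IsIrreducible] (hρ : ρ.IsAdmissible) (hsph : ρ.IsSpherical (glInt n F)) {ϖ : Fˣ}
    (hϖ : normAbs F (ϖ : F) = ((residueFieldCard F : ℝ≥0))⁻¹) {α : Multiset ℂ}
    (hα : IsSatakeParameter ρ ϖ α) :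
    HasGJLFactor ρ μG (eulerPolynomial α) ↔
      ∀ Φ ∈ SchwartzBruhat (Matrix (Fin n) (Fin n) F), ∀ φ ∈ ρ.contragredient, ∀ v : V,
        ∃ R : RatFunc ℂ, IsLaurent R ∧ EqOnRightHalfPlane (residueFieldCard F)
          (fun s => gjLocalZeta μG Φ (ρ.matrixCoeff φ v) (s + ((n : ℂ) - 1) / 2))
          (R * rsLRat (eulerPolynomial α)) :=
  ⟨fun h => h.2.1, fun h => ⟨eval_zero_eulerPolynomial α, h,
    inZetaSpan_eulerPolynomial_of_isSatakeParameter μG ρ hρ hsph hϖ hα⟩⟩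

end PartB

/-! ### Laurent bookkeeping: powers `|det w|^{s + c}` as monomials in `q^{-s}` -/

section Laurent

variable {F : Type*} [Field F] [ValuativeRel F] [TopologicalSpace F] [IsNonarchimedeanLocalField F]
  {n : ℕ}

/-- **`|det w|^t` is an integral power of `q^{-t}`**: for `w ∈ GL_n(F)` there is `k ∈ ℤ`
(`|det w| = q^{-k}`) with `|det w|^t = (q^{-t})^k` for all `t ∈ ℂ` (`normAbs` takes values in
`q^ℤ` on `F^×`, `DeltaCharBorel.normAbs_eq_zpow_log`; the power identity `(q^m)^t = (q^{-t})^{-m}`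
holds as `log q` is real). [folklore] -/
theorem exists_int_cpow_normAbs_det_eq (w : GL (Fin n) F) :
    ∃ k : ℤ, ∀ t : ℂ, (((normAbs F ((Matrix.GeneralLinearGroup.det w : Fˣ) : F) : ℝ≥0) : ℝ) : ℂ) ^ t =
      ((residueFieldCard F : ℂ) ^ (-t)) ^ k := by
  set q : ℕ := residueFieldCard F with hqdef
  have hx0 : ((Matrix.GeneralLinearGroup.det w : Fˣ) : F) ≠ 0 := Units.ne_zero _
  set m : ℤ := WithZero.log (_root_.IsNonarchimedeanLocalField.valueGroupWithZeroIsoInt F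
    (valuation F ((Matrix.GeneralLinearGroup.det w : Fˣ) : F))) with hmdef
  have hnorm : normAbs F ((Matrix.GeneralLinearGroup.det w : Fˣ) : F) = (q : ℝ≥0) ^ m :=
    DeltaCharBorel.normAbs_eq_zpow_log hx0
  refine ⟨-m, fun t => ?_⟩
  have hq0 : (q : ℂ) ≠ 0 := Nat.cast_ne_zero.mpr (residueFieldCard_ne_zero F)
  have hlog : (Complex.log (q : ℂ)).im = 0 := by
    rw [show (q : ℂ) = ((q : ℝ) : ℂ) by norm_cast, ← Complex.ofReal_log (Nat.cast_nonneg q)]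
    exact Complex.ofReal_im _
  have him : (Complex.log (q : ℂ) * (m : ℂ)).im = 0 := by
    simp [Complex.mul_im, hlog]
  rw [hnorm, NNReal.coe_zpow, NNReal.coe_natCast, Complex.ofReal_zpow, Complex.ofReal_natCast,
    ← Complex.cpow_intCast, ← Complex.cpow_mul _ (by rw [him]; exact neg_lt_zero.mpr Real.pi_pos)
      (by rw [him]; exact Real.pi_pos.le), ← Complex.cpow_int_mul]
  congr 1
  push_cast
  ring

/-- A Laurent monomial realising `s ↦ a (q^{-s})^k` (`k ∈ ℤ`): there is a Laurent `R ∈ ℂ(T)` with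
`R(q^{-s}) = a (q^{-s})^k` for `re s` large (`R = a T^{k+N} / T^N`, `N = |k|`). [folklore] -/
theorem exists_isLaurent_eventually_evalAtQ_eq_monomial {q : ℕ} (hq : 1 < q) (a : ℂ) (k : ℤ) :
    ∃ R : RatFunc ℂ, IsLaurent R ∧
      ∀ᶠ s in rightHalfPlanes, evalAtQ q R s = a * ((q : ℂ) ^ (-s)) ^ k := by
  set N : ℕ := k.natAbs with hN
  have hkN : 0 ≤ k + N := by
    have h1 : -k ≤ ((-k).natAbs : ℤ) := Int.le_natAbs
    rw [Int.natAbs_neg] at h1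
    simp only [hN]; omega
  set Q : ℂ[X] := Polynomial.C a * X ^ (k + N).toNat with hQ
  set R : RatFunc ℂ := algebraMap ℂ[X] (RatFunc ℂ) Q / RatFunc.X ^ N with hR
  refine ⟨R, ⟨Q, N, rfl⟩, ?_⟩
  have hXN : RatFunc.X ^ N = algebraMap ℂ[X] (RatFunc ℂ) (X ^ N) := by
    rw [map_pow, RatFunc.algebraMap_X]
  have hmul : R * RatFunc.X ^ N = algebraMap ℂ[X] (RatFunc ℂ) Q := by
    rw [hR, div_mul_cancel₀ _ (pow_ne_zero _ RatFunc.X_ne_zero)]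
  filter_upwards [eventually_evalAtQ_mul hq R (RatFunc.X ^ N)] with s hs
  have hx0 : (q : ℂ) ^ (-s) ≠ 0 := natCast_cpow_neg_ne_zero (zero_lt_one.trans hq) s
  have hXNs : evalAtQ q (RatFunc.X ^ N) s = ((q : ℂ) ^ (-s)) ^ N := by
    rw [hXN, evalAtQ_algebraMap, Polynomial.eval_pow, Polynomial.eval_X]
  rw [hmul, evalAtQ_algebraMap, hXNs, hQ, Polynomial.eval_mul, Polynomial.eval_C, Polynomial.eval_pow,
    Polynomial.eval_X] at hs
  have hpow : ((q : ℂ) ^ (-s)) ^ (k + N).toNat = ((q : ℂ) ^ (-s)) ^ k * ((q : ℂ) ^ (-s)) ^ N := by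
    rw [← zpow_natCast, Int.toNat_of_nonneg hkN, zpow_add₀ hx0, zpow_natCast]
  rw [hpow, ← mul_assoc] at hs
  exact mul_right_cancel₀ (pow_ne_zero _ hx0) hs.symm

/-- **Finite sums of `|det u_i|^{s + c}` are Laurent in `q^{-s}`**: for finitely many `β_i ∈ ℂ`,
`u_i ∈ GL_n(F)` and a fixed shift `c`, there is a Laurent `R ∈ ℂ(T)` with
`R(q^{-s}) = ∑_i β_i |det u_i|^{s + c}` for `re s` large (`|det u|^{s+c} = (q^{-c})^k (q^{-s})^k`,
`exists_int_cpow_normAbs_det_eq`). [folklore] -/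
theorem exists_isLaurent_eventually_evalAtQ_eq_sum {m : ℕ} (β : Fin m → ℂ) (u : Fin m → GL (Fin n) F)
    (c : ℂ) :
    ∃ R : RatFunc ℂ, IsLaurent R ∧ ∀ᶠ s in rightHalfPlanes, evalAtQ (residueFieldCard F) R s =
      ∑ i, β i * (((normAbs F ((Matrix.GeneralLinearGroup.det (u i) : Fˣ) : F) : ℝ≥0) : ℝ) : ℂ) ^ (s + c) := by
  classical
  set q : ℕ := residueFieldCard F with hqdef
  have hq : 1 < q := one_lt_residueFieldCard F
  have hq0 : (q : ℂ) ≠ 0 := Nat.cast_ne_zero.mpr (residueFieldCard_ne_zero F)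
  choose k hk using fun i => exists_int_cpow_normAbs_det_eq (u i)
  choose R hR hRev using fun i =>
    exists_isLaurent_eventually_evalAtQ_eq_monomial hq (β i * ((q : ℂ) ^ (-c)) ^ (k i)) (k i)
  refine ⟨∑ i, R i, IsLaurent.sum _ fun i _ => hR i, ?_⟩
  filter_upwards [eventually_evalAtQ_sum hq Finset.univ R, Filter.eventually_all.mpr hRev] with s hs hev
  rw [hs]
  refine Finset.sum_congr rfl fun i _ => ?_
  rw [hev i, hk i (s + c), neg_add, Complex.cpow_add _ _ hq0, mul_zpow]
  ring

/-- **From the unramified shape to `HasGJLFactor`'s clause (a).** If `Z(s)` equals, for `re s`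
large, `(∑_{h ∈ A} ∑_{g ∈ B} γ_{h,g} · B_{h,g}(s)) · r · P(q^{-s})⁻¹` where each `B_{h,g}(s)` is a
finite sum `∑_i β_i |det u_i|^{s + c}`, then `Z` agrees for `re s` large with `R(q^{-s}) / P(q^{-s})`
for a Laurent polynomial `R` (`exists_isLaurent_eventually_evalAtQ_eq_sum`, the eventual ring
homomorphism property of `R ↦ R(q^{-s})`, and `eval_rsLRat`). [folklore] -/
theorem exists_isLaurent_eqOnRightHalfPlane_of_eq_sum {ι κ : Type*} (A : Finset ι) (B : Finset κ)
    (γ : ι → κ → ℂ) (m : ι → κ → ℕ) (β : (h : ι) → (g : κ) → Fin (m h g) → ℂ)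
    (u : (h : ι) → (g : κ) → Fin (m h g) → GL (Fin n) F) (c r : ℂ) {P : ℂ[X]} (hP : P ≠ 0)
    (Z : ℂ → ℂ) (c₀ : ℝ)
    (hZ : ∀ s : ℂ, c₀ < s.re → Z s = (∑ h ∈ A, ∑ g ∈ B, γ h g *
      ∑ i, β h g i * (((normAbs F ((Matrix.GeneralLinearGroup.det (u h g i) : Fˣ) : F) : ℝ≥0) : ℝ) :
        ℂ) ^ (s + c)) * (r * (P.eval ((residueFieldCard F : ℂ) ^ (-s)))⁻¹)) :
    ∃ R : RatFunc ℂ, IsLaurent R ∧ EqOnRightHalfPlane (residueFieldCard F) Z (R * rsLRat P) := by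
  classical
  set q : ℕ := residueFieldCard F with hqdef
  have hq : 1 < q := one_lt_residueFieldCard F
  choose R hR hRev using fun h g => exists_isLaurent_eventually_evalAtQ_eq_sum (β h g) (u h g) c
  set Rtot : RatFunc ℂ := ∑ h ∈ A, ∑ g ∈ B, RatFunc.C (γ h g * r) * R h g with hRtot
  have hLC : ∀ x : ℂ, IsLaurent (RatFunc.C x) := fun x => by
    simpa [RatFunc.algebraMap_C] using isLaurent_algebraMap (Polynomial.C x)
  refine ⟨Rtot, IsLaurent.sum _ fun h _ => IsLaurent.sum _ fun g _ => (hLC _).mul (hR h g), ?_⟩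
  rw [eqOnRightHalfPlane_iff]
  have hev : ∀ᶠ s in rightHalfPlanes, evalAtQ q Rtot s =
      ∑ h ∈ A, ∑ g ∈ B, γ h g * r * evalAtQ q (R h g) s := by
    filter_upwards [eventually_evalAtQ_sum hq A (fun h => ∑ g ∈ B, RatFunc.C (γ h g * r) * R h g),
      Filter.eventually_all_finset A |>.mpr fun h _ => eventually_evalAtQ_sum hq B
        (fun g => RatFunc.C (γ h g * r) * R h g),
      Filter.eventually_all_finset A |>.mpr fun h _ => Filter.eventually_all_finset B |>.mpr
        fun g _ => eventually_evalAtQ_mul hq (RatFunc.C (γ h g * r)) (R h g)] with s h1 h2 h3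
    rw [hRtot, h1]
    refine Finset.sum_congr rfl fun h hh => ?_
    rw [h2 h hh]
    refine Finset.sum_congr rfl fun g hg => ?_
    rw [h3 h hh g hg, evalAtQ_C]
  have hc₀ : ∀ᶠ s : ℂ in rightHalfPlanes, c₀ < s.re := eventually_rightHalfPlanes_iff.mpr ⟨c₀, fun _ h => h⟩
  filter_upwards [hev, hc₀, eventually_evalAtQ_mul hq Rtot (rsLRat P),
    Filter.eventually_all_finset A |>.mpr fun h _ => Filter.eventually_all_finset B |>.mpr
      fun g _ => hRev h g] with s h1 h2 h3 h4
  rw [h3, h1, hZ s h2, evalAtQ, eval_rsLRat hP, Finset.sum_mul, Finset.sum_mul]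
  refine Finset.sum_congr rfl fun h hh => ?_
  rw [Finset.sum_mul, Finset.sum_mul]
  refine Finset.sum_congr rfl fun g hg => ?_
  rw [h4 h hh g hg]
  ring

end Laurent

/-! ### Discharge of the unramified `L`-factor -/

section Unramified

variable {F : Type} [Field F] [ValuativeRel F] [TopologicalSpace F] [IsNonarchimedeanLocalField F]
  {n : ℕ}

/-- **The unramified local `L`-factor (Godement–Jacquet (1972), §6 with Thm. 3.3; Jacquet (1979),
(1.4)) holds**: discharge of the named fact `GodementJacquet1972_hasGJLFactor_of_isSatakeParameter`
of `GodementJacquetLocal` — for an irreducible admissible representation `π` of `GL_n(F)` which is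
spherical for `K = GL_n(𝒪)` with Satake parameter `α` (`|ϖ| = q⁻¹`) and every Haar measure `μG`,
`HasGJLFactor ρ μG (∏_i (1 - α_i T))`, i.e. `L(s, π) = ∏_i (1 - α_i q^{-s})⁻¹` is the g.c.d. of
the zeta integrals `Z(Φ, s + (n-1)/2, f)`.

Proof. By `hasGJLFactor_eulerPolynomial_iff_of_isSatakeParameter` (conjunct (b) is Lemma 6.10)
it remains to show that every `Z(Φ, s + (n-1)/2, ⟨π(·) v, φ⟩)` is `R(q^{-s}) / ∏ (1 - α_i q^{-s})`
for `re s ≫ 0` with `R` Laurent. Let `v°` be the spherical vector, `φ° ∈ Ṽ^K` with `φ°(v°) = 1`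
and `ω = ⟨π(·) v°, φ°⟩`. By cyclicity of `v°` in `V` and of `φ°` in the irreducible `Ṽ`
(`exists_finsupp_sum_smul_apply_eq`, `isIrreducible_contragredient_holds`),
`⟨π(x) v, φ⟩ = ∑_{h,g} d_h c_g ω(h⁻¹ x g)`, and for `re s` beyond the abscissa of
`GodementJacquet1972_local_convergence_holds` the zeta integral splits accordingly. Each term is
`|det g⁻¹|^{s'} |det h|^{s'} Z(Φ(h · g⁻¹), s', ω)` (`gjLocalZeta_matrixCoeff_apply`,
`gjLocalZeta_matrixCoeff_dual`; Haar measures on `GL_n(F)` are right invariant,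
`isMulRightInvariant_of_isHaarMeasure_gl`), then `∑_i c_i Z(1_M(z_i⁻¹ ·), s', ω)`
(`exists_gjLocalZeta_eq_sum_indicator`: right `K`-average and the Möbius/lattice expansion of
`SchwartzBruhatLatticeSpan`), then `∑_i c_i |det z_i|^{s'} ω(z_i) Z(1_M, s', ω)`
(`gjLocalZeta_indicator_mul_left_eq_spherical`), and `Z(1_M, s + (n-1)/2, ω) = μG(K) ∏ (1 - α_i q^{-s})⁻¹`
by `GodementJacquet1972_lemma610_holds` (renormalised Haar measure). The resulting finite sum of
`γ_j |det u_j|^{s + (n-1)/2}` is `R(q^{-s})` for a Laurent `R`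
(`exists_isLaurent_eqOnRightHalfPlane_of_eq_sum`). This replaces the printed route through the
divisibility `L(s, π)⁻¹ ∣ ∏ (1 - χ_i(ϖ) q^{-s})` for constituents of the unramified principal series
(LNM 260, §3). [cite: GodementJacquet1972, Lemma 6.10 with Thm. 3.3] -/
theorem GodementJacquet1972_hasGJLFactor_of_isSatakeParameter_holds :
    GodementJacquet1972_hasGJLFactor_of_isSatakeParameter (F := F) (n := n) := by
  intro _ _ μG _ V _ _ ρ _ hρ hsph ϖ hϖ α hα
  classical
  refine (hasGJLFactor_eulerPolynomial_iff_of_isSatakeParameter μG ρ hρ hsph hϖ hα).mpr ?_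
  intro Φ hΦ φ hφ v
  -- notation and basic facts
  have hq : 1 < residueFieldCard F := one_lt_residueFieldCard F
  have hE0 : eulerPolynomial α ≠ 0 := fun h => by
    have := eval_zero_eulerPolynomial α
    rw [h, Polynomial.eval_zero] at this
    exact zero_ne_one this
  -- topological instances on `GL_n(F)`; Haar measures on `GL_n(F)` are right invariant
  haveI : T2Space F := t2Space_of_isNonarchimedeanLocalField
  haveI : NonarchimedeanGroup (GL (Fin n) F) := nonarchimedeanGroup_gl F n
  haveI : LocallyCompactSpace (Matrix (Fin n) (Fin n) F) :=
    inferInstanceAs (LocallyCompactSpace (Fin n → Fin n → F))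
  haveI : LocallyCompactSpace (GL (Fin n) F) := inferInstance
  haveI : μG.IsMulRightInvariant := isMulRightInvariant_of_isHaarMeasure_gl μG
  -- the spherical vector `v₀` and a normalised `K`-invariant smooth form `φ₀`
  obtain ⟨v₀, hv₀, hv₀0, -⟩ := hα.2
  obtain ⟨f, hf, hfK, hfv⟩ :=
    hρ.isSmooth.exists_mem_contragredient_apply_ne_zero_of_mem_fixedPoints (isOpen_glInt n F)
      (isCompact_glInt n F) hv₀ hv₀0
  set φ₀ : Module.Dual ℂ V := (f v₀)⁻¹ • f with hφ₀def
  have hφ₀ : φ₀ ∈ ρ.contragredient := Submodule.smul_mem _ _ hf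
  have hφ₀K : φ₀ ∈ ρ.dual.fixedPoints (glInt n F) := by
    rw [Representation.mem_fixedPoints]
    intro g hg
    rw [hφ₀def, map_smul, hfK g hg]
  have h1 : φ₀ v₀ = 1 := by
    rw [hφ₀def, LinearMap.smul_apply, smul_eq_mul, inv_mul_cancel₀ hfv]
  clear_value φ₀
  have hωK : ∀ k ∈ glInt n F, ∀ x : GL (Fin n) F,
      ρ.matrixCoeff φ₀ v₀ (x * k) = ρ.matrixCoeff φ₀ v₀ x := by
    intro k hk x
    simp only [Representation.matrixCoeff_apply, map_mul, Module.End.mul_apply,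
      (ρ.mem_fixedPoints _ v₀).1 hv₀ k hk]
  -- absolute convergence of all zeta integrals (Thm. 3.3 (1))
  obtain ⟨s₀, hs₀⟩ := GodementJacquet1972_local_convergence_holds μG ρ hρ
  -- Lemma 6.10 for `μG`, through the renormalised Haar measure `μG(K)⁻¹ μG`
  have hKm0 : μG (glInt n F : Set (GL (Fin n) F)) ≠ 0 :=
    (isOpen_glInt n F).measure_ne_zero μG ⟨1, (glInt n F).one_mem⟩
  have hKtop : μG (glInt n F : Set (GL (Fin n) F)) ≠ ⊤ := (isCompact_glInt n F).measure_lt_top.ne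
  set μ' : Measure (GL (Fin n) F) := (μG (glInt n F : Set (GL (Fin n) F)))⁻¹ • μG with hμ'def
  haveI : μ'.IsHaarMeasure :=
    Measure.IsHaarMeasure.smul μG (ENNReal.inv_ne_zero.mpr hKtop) (ENNReal.inv_ne_top.mpr hKm0)
  have hμ'K : μ' (glInt n F : Set (GL (Fin n) F)) = 1 := by
    rw [hμ'def, Measure.smul_apply, smul_eq_mul, ENNReal.inv_mul_cancel hKm0 hKtop]
  obtain ⟨c₆, hc₆⟩ := GodementJacquet1972_lemma610_holds μ' hμ'K ρ hρ hsph hϖ hα hv₀ hφ₀K h1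
  set r : ℝ := (μG (glInt n F : Set (GL (Fin n) F))).toReal with hrdef
  have hr0 : r ≠ 0 := ENNReal.toReal_ne_zero.mpr ⟨hKm0, hKtop⟩
  have hZμ : ∀ s : ℂ, gjLocalZeta μG ((intMatrices n F).indicator 1) (ρ.matrixCoeff φ₀ v₀) s =
      (r : ℂ) * gjLocalZeta μ' ((intMatrices n F).indicator 1) (ρ.matrixCoeff φ₀ v₀) s := by
    intro s
    rw [gjLocalZeta, gjLocalZeta, hμ'def, integral_smul_measure, ENNReal.toReal_inv, ← hrdef,
      Complex.real_smul, ← mul_assoc, Complex.ofReal_inv, mul_inv_cancel₀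
      (Complex.ofReal_ne_zero.mpr hr0), one_mul]
  have h610 : ∀ s : ℂ, c₆ < s.re →
      gjLocalZeta μG ((intMatrices n F).indicator 1) (ρ.matrixCoeff φ₀ v₀) (s + ((n : ℂ) - 1) / 2) =
        (r : ℂ) * ((eulerPolynomial α).eval ((residueFieldCard F : ℂ) ^ (-s)))⁻¹ := by
    intro s hs
    rw [hZμ, (hc₆ s hs).2]
  -- cyclic expansions of `v` and `φ`
  obtain ⟨cv, hcv⟩ := exists_finsupp_sum_smul_apply_eq ρ hv₀0 v
  have hirr : ρ.contragredientRep.IsIrreducible :=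
    Representation.isIrreducible_contragredient_holds ρ hρ
  have hΦ₀0 : (⟨φ₀, hφ₀⟩ : ρ.Contragredient) ≠ 0 := fun h => by
    have : φ₀ = 0 := congrArg (Representation.Contragredient.subtype ρ) h
    rw [this, LinearMap.zero_apply] at h1
    exact zero_ne_one h1
  obtain ⟨d, hd⟩ := exists_finsupp_sum_smul_apply_eq ρ.contragredientRep hΦ₀0 ⟨φ, hφ⟩
  have hv : v = ∑ g ∈ cv.support, cv g • ρ g v₀ := by rw [← hcv]; rfl
  have hφ' : φ = ∑ h ∈ d.support, d h • ρ.dual h φ₀ := by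
    have := congrArg (Representation.Contragredient.subtype ρ) hd
    rw [Finsupp.sum, map_sum] at this
    rw [← show Representation.Contragredient.subtype ρ ⟨φ, hφ⟩ = φ from rfl, ← this]
    refine Finset.sum_congr rfl fun h _ => ?_
    rw [map_smul, Representation.subtype_contragredientRep_apply]
    rfl
  have key : ∀ x : GL (Fin n) F, φ (ρ x v) =
      ∑ h ∈ d.support, ∑ g ∈ cv.support, d h * cv g * φ₀ (ρ (h⁻¹ * x * g) v₀) := by
    intro x
    rw [hv, hφ', LinearMap.sum_apply]
    refine Finset.sum_congr rfl fun h _ => ?_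
    rw [LinearMap.smul_apply, map_sum, map_sum, smul_eq_mul, Finset.mul_sum]
    refine Finset.sum_congr rfl fun g _ => ?_
    rw [map_smul, map_smul, smul_eq_mul]
    simp only [Representation.dual_apply, Module.Dual.transpose_apply, LinearMap.comp_apply,
      map_mul, Module.End.mul_apply]
    ring
  -- the lattice data of the translated test functions `Φ(h · g⁻¹)`
  have hM : (intMatrices n F).indicator (1 : Matrix (Fin n) (Fin n) F → ℂ) ∈
      SchwartzBruhat (Matrix (Fin n) (Fin n) F) := indicator_intMatrices_mem_schwartzBruhat
  have hΨ : ∀ h g : GL (Fin n) F, (fun X => Φ ((h : Matrix (Fin n) (Fin n) F) * X *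
      ((g⁻¹ : GL (Fin n) F) : Matrix (Fin n) (Fin n) F))) ∈ SchwartzBruhat (Matrix (Fin n) (Fin n) F) :=
    fun h g => schwartzBruhat_comp_mul_left h (schwartzBruhat_comp_mul_right g⁻¹ hΦ)
  choose mB cB zB hB using fun h g : GL (Fin n) F =>
    exists_gjLocalZeta_eq_sum_indicator μG hM (hΨ h g)
  -- the abscissa and the algebraic reduction
  refine exists_isLaurent_eqOnRightHalfPlane_of_eq_sum d.support cv.support (fun h g => d h * cv g)
    mB (fun h g i => cB h g i * ρ.matrixCoeff φ₀ v₀ (zB h g i)) (fun h g i => h * zB h g i * g⁻¹)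
    (((n : ℂ) - 1) / 2) (r : ℂ) hE0 _ (max (s₀ + 1) c₆) fun s hs => ?_
  set s' : ℂ := s + ((n : ℂ) - 1) / 2 with hs'def
  have hs₀' : s₀ < s'.re := by
    have e1 : s'.re = s.re + ((n : ℝ) - 1) / 2 := by
      simp [hs'def, Complex.add_re, Complex.div_ofNat_re]
    rw [e1]
    have h0 : (0 : ℝ) ≤ n := Nat.cast_nonneg n
    have h2 : s₀ + 1 ≤ max (s₀ + 1) c₆ := le_max_left _ _
    linarith
  have hc₆s : c₆ < s.re := lt_of_le_of_lt (le_max_right _ _) hs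
  have hint : ∀ Φ' ∈ SchwartzBruhat (Matrix (Fin n) (Fin n) F), ∀ φ' ∈ ρ.contragredient, ∀ v' : V,
      Integrable (gjLocalIntegrand Φ' (ρ.matrixCoeff φ' v') s') μG :=
    fun Φ' hΦ' φ' hφ' v' => hs₀ Φ' hΦ' φ' hφ' v' s' hs₀'
  -- (1) split the zeta integral along the cyclic expansions
  have hE1 : gjLocalZeta μG Φ (ρ.matrixCoeff φ v) s' = ∑ h ∈ d.support, ∑ g ∈ cv.support,
      (d h * cv g) * gjLocalZeta μG Φ (ρ.matrixCoeff (ρ.dual h φ₀) (ρ g v₀)) s' := by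
    have hexp : gjLocalIntegrand Φ (ρ.matrixCoeff φ v) s' = fun x => ∑ h ∈ d.support, ∑ g ∈ cv.support,
        (d h * cv g) * gjLocalIntegrand Φ (ρ.matrixCoeff (ρ.dual h φ₀) (ρ g v₀)) s' x := by
      funext x
      simp only [gjLocalIntegrand, Representation.matrixCoeff_apply]
      rw [key x, Finset.mul_sum, Finset.sum_mul]
      refine Finset.sum_congr rfl fun h _ => ?_
      rw [Finset.mul_sum, Finset.sum_mul]
      refine Finset.sum_congr rfl fun g _ => ?_
      have e : (ρ.dual h φ₀) (ρ x (ρ g v₀)) = φ₀ (ρ (h⁻¹ * x * g) v₀) := by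
        simp only [Representation.dual_apply, Module.Dual.transpose_apply, LinearMap.comp_apply,
          map_mul, Module.End.mul_apply]
      rw [e]
      ring
    have hint' : ∀ h g : GL (Fin n) F,
        Integrable (gjLocalIntegrand Φ (ρ.matrixCoeff (ρ.dual h φ₀) (ρ g v₀)) s') μG :=
      fun h g => hint Φ hΦ _ (ρ.contragredient.apply_mem_toSubmodule h hφ₀) _
    unfold gjLocalZeta
    rw [hexp, integral_finsetSum _ fun h _ =>
      integrable_finsetSum _ fun g _ => (hint' h g).const_mul _]
    refine Finset.sum_congr rfl fun h _ => ?_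
    rw [integral_finsetSum _ fun g _ => (hint' h g).const_mul _]
    refine Finset.sum_congr rfl fun g _ => ?_
    rw [integral_const_mul]
  -- (2) each term: translations, lattice reduction, spherical identity
  have hE2 : ∀ h g : GL (Fin n) F, gjLocalZeta μG Φ (ρ.matrixCoeff (ρ.dual h φ₀) (ρ g v₀)) s' =
      (∑ i, (cB h g i * ρ.matrixCoeff φ₀ v₀ (zB h g i)) *
        (((normAbs F ((Matrix.GeneralLinearGroup.det (h * zB h g i * g⁻¹) : Fˣ) : F) : ℝ≥0) : ℝ) :
          ℂ) ^ s') *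
        gjLocalZeta μG ((intMatrices n F).indicator 1) (ρ.matrixCoeff φ₀ v₀) s' := by
    intro h g
    rw [gjLocalZeta_matrixCoeff_apply ρ μG Φ _ v₀ g s', gjLocalZeta_matrixCoeff_dual ρ μG _ φ₀ v₀ h s']
    have hBhg := hB h g (ρ.matrixCoeff φ₀ v₀) hωK s' (fun Φ' hΦ' => hint Φ' hΦ' φ₀ hφ₀ v₀)
    change _ * (_ * gjLocalZeta μG (fun X => Φ ((h : Matrix (Fin n) (Fin n) F) * X *
      ((g⁻¹ : GL (Fin n) F) : Matrix (Fin n) (Fin n) F))) (ρ.matrixCoeff φ₀ v₀) s') = _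
    rw [hBhg, Finset.mul_sum, Finset.mul_sum, Finset.sum_mul]
    refine Finset.sum_congr rfl fun i _ => ?_
    rw [gjLocalZeta_indicator_mul_left_eq_spherical ρ μG hρ.isSmooth hsph hv₀ hφ₀ hφ₀K h1 (zB h g i) s'
      (fun φ' hφ' => hint _ hM φ' hφ' v₀), cpow_normAbs_det_mul, cpow_normAbs_det_mul]
    ring
  -- (3) assemble with Lemma 6.10
  change gjLocalZeta μG Φ (ρ.matrixCoeff φ v) s' = _
  rw [hE1, Finset.sum_mul]
  refine Finset.sum_congr rfl fun h _ => ?_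
  rw [Finset.sum_mul]
  refine Finset.sum_congr rfl fun g _ => ?_
  rw [hE2 h g, h610 s hc₆s]
  ring

end Unramified

end Literature.NumberTheory.Automorphic
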